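import Summits.HodgeConjecture.HodgeConjecture.Theorems.R90S9DefiniteAeRigidityPayLine      -- ★ p863000 (R90-IF-p06, (δ6c)) — ★ CONE: J10 `hχ𝓕`, `Ch14Bridge`, (S7) `sec146_of_levels'`, Gelfand level, LevelPins, `evpRepOf_of_eventuallyEq_of_evpFin`, `RoutesAt`, ★ S5 `xi_eq_of_routesAt_of_memXiFamily_of_not_mem`, D6 `MemXiFamily`
import Summits.HodgeConjecture.HodgeConjecture.Theorems.R90S9HcoeffMemChainA2          -- ★ M2b (R90-IF-p03 (g3), «A2»): `hcoeffMem_binder_gammaSph_recordSCD_atUnitsOfRecord_partnerA2'` — ROW-34 TOKEN with the TWO archimedean members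
import Summits.HodgeConjecture.HodgeConjecture.Theorems.R90S9EvpRigidityOfCore           -- ★ p863121 (R90-IF-p04 (g2), (e5′)): `InnerFormSec146.gradeRep_eq_of_evpRigidityCore`
import Summits.HodgeConjecture.HodgeConjecture.Theorems.R90S9HmnAtDeepLevelDatumA            -- ★ p863705 (R90-IF-p07 (g2), (LF-3)): §1 `R90.S9.hasSum_fibre_indicator_of_tsum_eq_at`; cone ★ p863577 + ★ p863655
import Summits.HodgeConjecture.HodgeConjecture.Theorems.R90S9ArchFinTraceSplitOfFrame       -- ★ p863065 (R90-IF-p04 (g2)): `R90.S9.archFinTraceSplit_of_frame` — `hAFS` from `hdef` + `h2`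
import HarnessLib

/-!
# R90-TF · S9 «InnerForm-13.3.6 (c)» — (γ2) `memXiFamily_payLine_stableA2'`: ★ M3's HEAD RE-CONCLUDED IN THE ENVELOPE CURRENCY — «a.e. ROUTED through `Π′(ξ)` ⟹ `P ∈` ξ-ENVELOPE `MemXiFamily P … ξ`»
# (Rogawski 1990, Thm. 14.6.4 pp. 243–244: `Π′ ∈ Π_a(G′)` ⇒ `Π′ = Π′(ξ)`, `Π′(ξ)_v = Π(ξ_v)` for `v ∉ S₀`; §13.3 p. 201) — S5's row (γ2) `hRigXi` (`Theorems/R90S5ATransportOfRows.lean` :79–:80) AT THE RECORD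

Cell `hodgecm-mathlib`, crux H413 (`stmt-HodgeConjecture-24833`, `--supports … --as helper`); seat R90-IF-p02 (g3); dealer R90-IF-plan (g3) DEALS #1 2026-09-05T03:50:55Z (γ2); census
`R90/R90-IF-p02/g3/CENSUS-gamma2-hRigXi.md` 23a4e7eab346d92c (VERDICT ORGAN-TWIN: the (S-G) tail of ★ M3 `definiteAeRigidity_payLine_stableA2'` (p864612) is silent at split places while the
envelope pins every split place, so the envelope is read off the engine's core BEFORE its `hback` read-back, not off the head's statement).
THIS FILE = ★ M3 `Theorems/R90S9DefiniteAeRigidityStableRouteA2.lean` TOKEN FOR TOKEN with: (ⅰ) BINDER BLOCK byte-identical EXCEPT the (AE) binder `hAE` (M3 :89–:96) DELETED and S5's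
ROUTING TOKEN `(hrt : ∀ᶠ v in cofinite, clFinChoice P v = (Ξ_recordSCD ξ v).πn)` APPENDED LAST (it mentions `μZ keys hQS`, which sit after `hAE`'s slot) — B feeds it with the head's σ
minus the `hAE` argument plus the row's hypothesis; no idle binder (the inlined engine core consumes `hcoverR hframe hDisj htri hApkt` via (S7) and `hli hvan144G hvan144H` via `hmn`);
(ⅱ) CONCLUSION `MemXiFamily P hH hHd μω hμu ξ` (★ D6); (ⅲ) BODY = ★ M3 :318–:366 VERBATIM (`hμ hμK1 hν hleft`, J10 `hχ𝓕`, (14.6.1) `h61`, Gelfand `l₀`, `hlevTA`, `hrigD`, (MN) `hmn`, (CMP)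
`hcoeffMem` ★ M2b′), (S7) `h64 := sec146_of_levels' …` = ★ M3's engine argument :371–:381 token for token, `hevp` FROM THE ROUTING TOKEN (★ `evpRepOf_of_eventuallyEq_of_evpFin` + ★
`evp_piXiPrime_iff` on `hevpXi`, `rfl`-read as `Γ₀.evpRep [P] Π(ξ)` — replaces M3's (AE)-string route), THE ENGINE'S CORE (★ `definiteAeRigidityAt_of_thm1461'` :234–:242) INLINED WITHOUT
`hback` (partition ⟹ `[P] ∈ Π′`; `t(Π′) = t(Π(ξ))`; `Π′ ∈ Π_a(G′)`; Thm. 14.6.4 (a) `Π′ = Π′(ξ′)`), the ENVELOPE READ-BACK kept whole (`[P] ∈ Π′(ξ′)` is `LocalConstituentsIn P (Ξ_rec ξ″)`,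
`ξ″ := X.oneDimOf ξ′ h₁`, ★ `gammaSph_mem'_piXi'_classOfSph`; `Ξ_rec ξ″` IS a ξ″-local family, ★ `isXiLocalFamily_xiPacketFamilyOfRecordSCD`), and Thm. 14.6.4's UNIQUE `ξ`: the token
gives ★ `RoutesAt … P ξ v` off its exceptional set (★ `xiPacketFamilyOfRecordSCD_of_split`∕`_of_nonsplit` + ★ `comap_cmDatumLocalCongr_symm_eq`) and ★ S5
`xi_eq_of_routesAt_of_memXiFamily_of_not_mem` (split places; constituent supply ★ `admUnitConstituents_nonempty_of_anisotropic`) gives `ξ = ξ″`.  RELATION TO THE HEAD: same hypotheses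
(all 25 named debts of B ED. 4, payer map 2bc3a45c; none added); conclusions incomparable (∃ frame ∕ «some supercuspidal» at non-split `v`, but EVERY split place pinned); GUARD: `P` is
`K_c`-spherical (`hsph`), as in every S9 organ (junction word to S5).  CONSUMER: S5's `hRigXi` at the record = ONE producer row under the head's σ (typ2), feeding socket (γ) of S5-A3.
THEOREMS ONLY (no `def`∕instance∕notation∕named fact∕`sorry`); imports ★ only, no `Lines`; axioms TRIO.  HONEST LABEL: HC_CM is proved only modulo the 7 printed citations (2 remaining named
inputs: hLiu418 = stmt-HodgeConjecture-24832, h413 = stmt-HodgeConjecture-24833) until rung 0 closes; bookkeeping over ★ M3's organ — (14.6.1)'s inputs `hG hH61 hvan hvanH h51k`, the twist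
laws, `hcore`, the A2 arch letters, `hex`, the pins `Pξ hA hevpXi` and every other letter are HYPOTHESES; nothing unconditional is exported; no socket is paid until an edition consumes it.
[cite: Rogawski1990, §14.6 Thm. 14.6.1 p. 241, p. 242 (14.6.2)–(14.6.3), Thm. 14.6.4 and its proof pp. 243–245; §13.3 p. 201, Thm. 13.3.5 p. 202, Thm. 13.3.7 pp. 202–203; §13.1 p. 199, Prop. 13.1.3 (d), Prop. 13.1.4; §12.2 (2) p. 174; §12.3 Prop. 12.3.3 p. 178; §14.4 Props. 14.4.1 (a)(c), 14.4.2 (c) p. 236; §14.5 Thm. 14.5.1 (b) p. 238; §13.6 Prop. 13.6.1 p. 208; §4.13 Lemma 4.13.1 (b) p. 62; §14.2 p. 232]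
[cite: FlathCorvallis1979, Thm. 3, Thm. 4] [cite: HarishChandra1953, Thms. 4–6] [cite: LabesseLanglands1979, Lemma 6.1] [cite: CartierCorvallis1979, §IV.1 Cor. 4.1]
-/

set_option autoImplicit false
-- the mandated namespace repeats `HodgeConjecture.HodgeConjecture`, as in every `Theorems/*.lean` of this sub-problem
set_option linter.dupNamespace false
noncomputable section
open NumberField IsDedekindDomain MeasureTheory
open scoped Matrix ComplexOrder
open Literature.NumberTheory Literature.NumberTheory.Automorphic Literature.NumberTheory.Automorphic.UnitaryGroup
open Literature.NumberTheory.Automorphic.IdeleClassGroup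
open Literature.NumberTheory.GaloisRepresentations
open Literature.NumberTheory.Rogawski1990
open Literature.RepresentationTheory.KonnoKonno2007 Literature.RepresentationTheory.KonnoKonno2007.RealDualPair
open Literature.RepresentationTheory.KonnoKonno2007.RealDualPair.UForm
open Literature.NumberTheory.Automorphic.UnitaryGroup.CotangentForms (cmCompactFactor)
namespace Summit.HodgeConjecture.HodgeConjecture.R90.S9
open Summit.HodgeConjecture.HodgeConjecture.Cruxes.H413
open Summit.HodgeConjecture.HodgeConjecture.Cruxes.H413.F0P3GlobalPacket Summit.HodgeConjecture.HodgeConjecture.Cruxes.H413.F0P3LocalPacketKit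
open Summit.HodgeConjecture.HodgeConjecture.Cruxes.H413.F0P3XiPacketFamilyOfRecordSCD (xiPacketFamilyOfRecordSCD hSCD_of_cmCharIdentityPackageTestSigned
  hSCD_of_cmCharIdentityPackageTestSigned_fst)
open Summit.HodgeConjecture.HodgeConjecture.Cruxes.H413.F0P3ClassTokenChoice (clFinChoice)
open scoped Classical in
set_option synthInstance.maxHeartbeats 400000 in
set_option maxHeartbeats 8000000 in
/-- **(γ2) `memXiFamily_payLine_stableA2'` — THE HEAD'S ORGAN IN THE ENVELOPE CURRENCY** — under ★ M3 `definiteAeRigidity_payLine_stableA2'`'s binder block (byte-identical, the (AE) binder `hAE` deleted, S5's routing token `hrt : ∀ᶠ v in cofinite, clFinChoice P v = (Ξ_recordSCD ξ v).πn` appended last), a `K_c`-spherical discrete `P` of the definite inner form `U(H)` that is a.e. ROUTED through the A-packet family of record `Π′(ξ)` LIES IN THE ξ-ENVELOPE: `MemXiFamily P hH hHd μω hμu ξ` — every finite local constituent of `P`, at EVERY finite place (split and ramified ones included), lies in the ξ-local family of record. Proof = ★ M3's body (J10 `hχ𝓕`, (14.6.1) `h61`, Gelfand level, `hlevTA`,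 `hrigD`, (MN) `hmn`, (CMP) `hcoeffMem`, (S7) `h64 := sec146_of_levels'`) + the engine's core without its `hback` (partition, `Π′ ∈ Π_a(G′)`, Thm. 14.6.4 (a) `Π′ = Π′(ξ′)`) + the envelope read-back kept whole (★ `gammaSph_mem'_piXi'_classOfSph`, ★ `isXiLocalFamily_xiPacketFamilyOfRecordSCD`) + Thm. 14.6.4's unique `ξ` from the split places (★ `RoutesAt` off the token's exceptional set, ★ `xi_eq_of_routesAt_of_memXiFamily_of_not_mem`). [cite: Rogawski1990, §14.6 Thm. 14.6.1 p. 241, Thm. 14.6.4 and its proof pp. 243–245; §13.3 p. 201, Thm. 13.3.5 p. 202; §13.1 Prop. 13.1.3 (d) p. 199; §12.2 (2) p. 174; §4.13 Lemma 4.13.1 (b) p. 62] [cite: FlathCorvallis1979, Thm. 3, Thm. 4] [cite: HarishChandra1953, Thms. 4–6] -/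
theorem memXiFamily_payLine_stableA2'
    (L : Type) [Field L] [NumberField L] [IsCMField L] (H : Matrix (Fin 3) (Fin 3) L)
    (hH : (H.map (cmConjRingHom L))ᵀ = H) (hHd : IsUnit H.det)
    [∀ v : HeightOneSpectrum (𝓞 ↥(maximalRealSubfield L)), MeasurableSpace ((cmDatum L 3 H).Local v)]
    [∀ v : HeightOneSpectrum (𝓞 ↥(maximalRealSubfield L)), MeasurableSpace ((cmDatum L 2 (Matrix.of fun i j : Fin 2 => if i.val + j.val + 1 = 2 then (1 : L) else 0)).Local v × (cmDatum L 1 (Matrix.of fun i j : Fin 1 => if i.val + j.val + 1 = 1 then (1 : L) else 0)).Local v)]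
    [∀ (v : HeightOneSpectrum (𝓞 ↥(maximalRealSubfield L))) (a : ((cmDatum L 2 (Matrix.of fun i j : Fin 2 => if i.val + j.val + 1 = 2 then (1 : L) else 0)).Local v × (cmDatum L 1 (Matrix.of fun i j : Fin 1 => if i.val + j.val + 1 = 1 then (1 : L) else 0)).Local v)),
      MeasurableSpace (((cmDatum L 2 (Matrix.of fun i j : Fin 2 => if i.val + j.val + 1 = 2 then (1 : L) else 0)).Local v × (cmDatum L 1 (Matrix.of fun i j : Fin 1 => if i.val + j.val + 1 = 1 then (1 : L) else 0)).Local v) ⧸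
        Subgroup.centralizer ({a} : Set ((cmDatum L 2 (Matrix.of fun i j : Fin 2 => if i.val + j.val + 1 = 2 then (1 : L) else 0)).Local v × (cmDatum L 1 (Matrix.of fun i j : Fin 1 => if i.val + j.val + 1 = 1 then (1 : L) else 0)).Local v)))]
    [∀ (v : HeightOneSpectrum (𝓞 ↥(maximalRealSubfield L))) (γ : (cmDatum L 3 H).Local v), MeasurableSpace ((cmDatum L 3 H).Local v ⧸ Subgroup.centralizer ({γ} : Set ((cmDatum L 3 H).Local v)))]
    (Δ : ∀ v : HeightOneSpectrum (𝓞 ↥(maximalRealSubfield L)), LocalTransferFactor L H v)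
    (mH : ∀ v : HeightOneSpectrum (𝓞 ↥(maximalRealSubfield L)), OrbitalMeasureFamily ((cmDatum L 2 (Matrix.of fun i j : Fin 2 => if i.val + j.val + 1 = 2 then (1 : L) else 0)).Local v × (cmDatum L 1 (Matrix.of fun i j : Fin 1 => if i.val + j.val + 1 = 1 then (1 : L) else 0)).Local v))
    (mG : ∀ v : HeightOneSpectrum (𝓞 ↥(maximalRealSubfield L)), OrbitalMeasureFamily ((cmDatum L 3 H).Local v))
    (νG : ∀ v : HeightOneSpectrum (𝓞 ↥(maximalRealSubfield L)), Measure ((cmDatum L 3 H).Local v))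
    (νH : ∀ v : HeightOneSpectrum (𝓞 ↥(maximalRealSubfield L)), Measure ((cmDatum L 2 (Matrix.of fun i j : Fin 2 => if i.val + j.val + 1 = 2 then (1 : L) else 0)).Local v × (cmDatum L 1 (Matrix.of fun i j : Fin 1 => if i.val + j.val + 1 = 1 then (1 : L) else 0)).Local v))
    [∀ v : HeightOneSpectrum (𝓞 ↥(maximalRealSubfield L)), BorelSpace ((cmDatum L 3 H).Local v)]
    [∀ v : HeightOneSpectrum (𝓞 ↥(maximalRealSubfield L)), BorelSpace ((cmDatum L 2 (Matrix.of fun i j : Fin 2 => if i.val + j.val + 1 = 2 then (1 : L) else 0)).Local v × (cmDatum L 1 (Matrix.of fun i j : Fin 1 => if i.val + j.val + 1 = 1 then (1 : L) else 0)).Local v)]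
    [∀ (v : HeightOneSpectrum (𝓞 ↥(maximalRealSubfield L))) (a : ((cmDatum L 2 (Matrix.of fun i j : Fin 2 => if i.val + j.val + 1 = 2 then (1 : L) else 0)).Local v × (cmDatum L 1 (Matrix.of fun i j : Fin 1 => if i.val + j.val + 1 = 1 then (1 : L) else 0)).Local v)),
      BorelSpace (((cmDatum L 2 (Matrix.of fun i j : Fin 2 => if i.val + j.val + 1 = 2 then (1 : L) else 0)).Local v × (cmDatum L 1 (Matrix.of fun i j : Fin 1 => if i.val + j.val + 1 = 1 then (1 : L) else 0)).Local v) ⧸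
        Subgroup.centralizer ({a} : Set ((cmDatum L 2 (Matrix.of fun i j : Fin 2 => if i.val + j.val + 1 = 2 then (1 : L) else 0)).Local v × (cmDatum L 1 (Matrix.of fun i j : Fin 1 => if i.val + j.val + 1 = 1 then (1 : L) else 0)).Local v)))]
    [∀ (v : HeightOneSpectrum (𝓞 ↥(maximalRealSubfield L))) (γ : (cmDatum L 3 H).Local v), BorelSpace ((cmDatum L 3 H).Local v ⧸ Subgroup.centralizer ({γ} : Set ((cmDatum L 3 H).Local v)))]
    [∀ v, (νG v).IsHaarMeasure] [∀ v, (νG v).IsMulRightInvariant] [∀ v, (νH v).IsHaarMeasure] [∀ v, (νH v).IsMulRightInvariant]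
    (hanis : ∀ x : Fin 3 → L, Literature.AlgebraicGeometry.ShimuraVarieties.hermForm (cmConjRingHom L) H x x = 0 → x = 0)
    (μω : HeckeCharacter L) (hμu : μω.IsUnitary)
    (hμω : ∀ x : Literature.NumberTheory.GaloisRepresentations.ideleGroup ↥(maximalRealSubfield L),
      μω (AdeleRing.ideleBaseChange (↥(maximalRealSubfield L)) L x) = quadraticHeckeCharCM L x)
    (hQS : CMCharIdentityPackageTestSigned L H hH hHd νH νG μω hμu Δ mH mG)
    (ι : L →+* ℂ) (T : GL (Fin 3) ℂ)
    (hT : (T : Matrix (Fin 3) (Fin 3) ℂ)ᴴ * H.map ι * (T : Matrix (Fin 3) (Fin 3) ℂ) = Literature.Geometry.ComplexHyperbolic.BallModel.J)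
    (ξ : OneDimAutRepH L)
    (μA : Measure (adelicGroupData (↥(maximalRealSubfield L)) L (IsCMField.complexConj L) 3 H).automorphicQuotient)
    [(adelicGroupData (↥(maximalRealSubfield L)) L (IsCMField.complexConj L) 3 H).IsAutomorphicMeasure μA]
    (P : DiscreteAutomorphicRep (adelicGroupData (↥(maximalRealSubfield L)) L (IsCMField.complexConj L) 3 H) μA)
    (hsph : InnerFormSec146.IsKcSpherical L ι H T hT μA P)
    [∀ v : HeightOneSpectrum (𝓞 ↥(maximalRealSubfield L)), MeasurableSpace (Gqs L v ⧸ Subgroup.center (Gqs L v))]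
    [∀ v : HeightOneSpectrum (𝓞 ↥(maximalRealSubfield L)), BorelSpace (Gqs L v ⧸ Subgroup.center (Gqs L v))]
    (μZ : ∀ v : HeightOneSpectrum (𝓞 ↥(maximalRealSubfield L)), Measure (Gqs L v ⧸ Subgroup.center (Gqs L v)))
    [∀ v : HeightOneSpectrum (𝓞 ↥(maximalRealSubfield L)), (μZ v).IsHaarMeasure]
    (keys : ∀ (ξ : OneDimAutRepH L) (v : HeightOneSpectrum (𝓞 ↥(maximalRealSubfield L))),
      (∀ w : PlacesOver L v, IsCMField.complexConj L • w.1 = w.1) →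
        {p : IrrClass (Gqs L v) × IrrClass (Gqs L v) //
          KeysCaseTwoLabels L v (μω.semilocalComponent L v) (torusLocalComponent L (IsCMField.complexConj L) v ξ.η)
            (torusLocalComponent L (IsCMField.complexConj L) v ξ.ψ) p.1 p.2 ∧
          p.1.IsSquareIntegrable (μZ v) ∧ ¬ p.2.IsSquareIntegrable (μZ v)})
    {H' : Matrix (Fin 3) (Fin 3) L} (𝔩 : ∀ v : HeightOneSpectrum (𝓞 ↥(maximalRealSubfield L)), LocalPacketKit L H' v)
    (μv : ∀ v : HeightOneSpectrum (𝓞 ↥(maximalRealSubfield L)), @Measure ((cmDatum L 3 H).Local v) (borel _))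
    [MeasurableSpace (adelicGroupData (↥(maximalRealSubfield L)) L (IsCMField.complexConj L) 3 H).Adelic] [BorelSpace (adelicGroupData (↥(maximalRealSubfield L)) L (IsCMField.complexConj L) 3 H).Adelic]
    (ν : Measure (adelicGroupData (↥(maximalRealSubfield L)) L (IsCMField.complexConj L) 3 H).Adelic) [IsFiniteMeasureOnCompacts ν]
    (νinf : @Measure (UnitaryGroup.arch (↥(maximalRealSubfield L)) L (IsCMField.complexConj L) 3 H) (borel _))
    -- `hAFS` DISCHARGED (★ `archFinTraceSplit_of_frame … hdef h2`, as in ★ p863803): its one letter `[L⁺:ℚ] ≥ 2`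
    (h2 : 2 ≤ Module.finrank ℚ ↥(maximalRealSubfield L))
    (hPH : F0P3LettersTraceFactorisation.IsProductHaar L H ν νinf μv)
    (X : InnerFormSec146.DatumInputs ((UnitaryGroup.arch (↥(maximalRealSubfield L)) L (IsCMField.complexConj L) 3 H → ℂ) ×
      (∀ v : HeightOneSpectrum (𝓞 ↥(maximalRealSubfield L)), (cmDatum L 3 H).Local v → ℂ))
      (CompactlySupportedContinuousMap (cmDatum L 3 (Matrix.of fun i j : Fin 3 => if i.val + j.val + 1 = 3 then (1 : L) else 0)).Adelic ℂ)
      (CompactlySupportedContinuousMap ((cmDatum L 2 (Matrix.of fun i j : Fin 2 => if i.val + j.val + 1 = 2 then (1 : L) else 0)).Adelic × (cmDatum L 1 (Matrix.of fun i j : Fin 1 => if i.val + j.val + 1 = 1 then (1 : L) else 0)).Adelic) ℂ) L ι H T hT μA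
      (xiPacketFamilyOfRecordSCD L H hH hHd μω hμu μZ keys (hSCD_of_cmCharIdentityPackageTestSigned L H hH hHd μω hμu Δ mH mG νG νH μZ hQS)) 𝔩)
    (htrX : ∀ (π' : (InnerFormSec146.RepPrimeSph L ι H T hT μA)) (p : ((UnitaryGroup.arch (↥(maximalRealSubfield L)) L (IsCMField.complexConj L) 3 H → ℂ) ×
      (∀ v : HeightOneSpectrum (𝓞 ↥(maximalRealSubfield L)), (cmDatum L 3 H).Local v → ℂ))),
      X.trPrime π' p = archTr₀ L ι H T hT νinf (InnerFormSec146.tupleOf L ι H T hT μA π').1 p.1 *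
        ∏ᶠ v, (letI : MeasurableSpace ((cmDatum L 3 H).Local v) := borel _;
          ((InnerFormSec146.tupleOf L ι H T hT μA π').2 v).smoothTrace (μv v) (p.2 v)))
    (hspecAll : ∀ (l : InnerFormSec146.Level L) (p : ((UnitaryGroup.arch (↥(maximalRealSubfield L)) L (IsCMField.complexConj L) 3 H → ℂ) ×
      (∀ v : HeightOneSpectrum (𝓞 ↥(maximalRealSubfield L)), (cmDatum L 3 H).Local v → ℂ))),
      InnerFormSec146.IsLevelTest L ι H T hT l p →
        Summable (fun c : InnerFormSec146.RepPrimeClass L H μA =>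
          (InnerFormSec146.mPrime L H μA c : ℂ) * F0P3SpectralSideOfRecord.trGp₀ (adelicGroupData (↥(maximalRealSubfield L)) L (IsCMField.complexConj L) 3 H) μA ν c (tensOfPair L H ι T hT p)) ∧
        X.traceL p = ∑' c : InnerFormSec146.RepPrimeClass L H μA,
          (InnerFormSec146.mPrime L H μA c : ℂ) * F0P3SpectralSideOfRecord.trGp₀ (adelicGroupData (↥(maximalRealSubfield L)) L (IsCMField.complexConj L) 3 H) μA ν c (tensOfPair L H ι T hT p))
    (Smooth : ((UnitaryGroup.arch (↥(maximalRealSubfield L)) L (IsCMField.complexConj L) 3 H → ℂ) ×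
      (∀ v : HeightOneSpectrum (𝓞 ↥(maximalRealSubfield L)), (cmDatum L 3 H).Local v → ℂ)) → Prop)
    (Transfer : ((UnitaryGroup.arch (↥(maximalRealSubfield L)) L (IsCMField.complexConj L) 3 H → ℂ) ×
      (∀ v : HeightOneSpectrum (𝓞 ↥(maximalRealSubfield L)), (cmDatum L 3 H).Local v → ℂ)) → (CompactlySupportedContinuousMap (cmDatum L 3 (Matrix.of fun i j : Fin 3 => if i.val + j.val + 1 = 3 then (1 : L) else 0)).Adelic ℂ) → Prop)
    (TransferH : ((UnitaryGroup.arch (↥(maximalRealSubfield L)) L (IsCMField.complexConj L) 3 H → ℂ) ×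
      (∀ v : HeightOneSpectrum (𝓞 ↥(maximalRealSubfield L)), (cmDatum L 3 H).Local v → ℂ)) → (CompactlySupportedContinuousMap ((cmDatum L 2 (Matrix.of fun i j : Fin 2 => if i.val + j.val + 1 = 2 then (1 : L) else 0)).Adelic × (cmDatum L 1 (Matrix.of fun i j : Fin 1 => if i.val + j.val + 1 = 1 then (1 : L) else 0)).Adelic) ℂ) → Prop)
    (SθG : (CompactlySupportedContinuousMap (cmDatum L 3 (Matrix.of fun i j : Fin 3 => if i.val + j.val + 1 = 3 then (1 : L) else 0)).Adelic ℂ) → ℂ)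
    (SθH : (CompactlySupportedContinuousMap ((cmDatum L 2 (Matrix.of fun i j : Fin 2 => if i.val + j.val + 1 = 2 then (1 : L) else 0)).Adelic × (cmDatum L 1 (Matrix.of fun i j : Fin 1 => if i.val + j.val + 1 = 1 then (1 : L) else 0)).Adelic) ℂ) → ℂ)
    (h51k : ∀ (f' : ((UnitaryGroup.arch (↥(maximalRealSubfield L)) L (IsCMField.complexConj L) 3 H → ℂ) ×
      (∀ v : HeightOneSpectrum (𝓞 ↥(maximalRealSubfield L)), (cmDatum L 3 H).Local v → ℂ)))
      (f : (CompactlySupportedContinuousMap (cmDatum L 3 (Matrix.of fun i j : Fin 3 => if i.val + j.val + 1 = 3 then (1 : L) else 0)).Adelic ℂ))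
      (fH : (CompactlySupportedContinuousMap ((cmDatum L 2 (Matrix.of fun i j : Fin 2 => if i.val + j.val + 1 = 2 then (1 : L) else 0)).Adelic × (cmDatum L 1 (Matrix.of fun i j : Fin 1 => if i.val + j.val + 1 = 1 then (1 : L) else 0)).Adelic) ℂ)),
      Smooth f' → Transfer f' f ∧ TransferH f' fH → X.traceL f' = SθG f + (1 / 2 : ℂ) * SθH fH)
    (PSVanish : (CompactlySupportedContinuousMap (cmDatum L 3 (Matrix.of fun i j : Fin 3 => if i.val + j.val + 1 = 3 then (1 : L) else 0)).Adelic ℂ) → Prop)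
    (PSVanishH : (CompactlySupportedContinuousMap ((cmDatum L 2 (Matrix.of fun i j : Fin 2 => if i.val + j.val + 1 = 2 then (1 : L) else 0)).Adelic × (cmDatum L 1 (Matrix.of fun i j : Fin 1 => if i.val + j.val + 1 = 1 then (1 : L) else 0)).Adelic) ℂ) → Prop)
    -- J8-R1: THE G-SIDE DISCRETE EXPANSION OF RECORD IS THE STABLE ONE (Prop. 13.6.1-reading «SΘ_G(f) = Σ n(Π) Tr Π(f)» on the vanishing class) — B: `sock_S9_stableSpecG_cm`
    (hG : X.G.StableDiscreteExpansionG X.tr SθG PSVanish)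
    (hH61 : X.G.StableDiscreteExpansionH X.trH SθH PSVanishH)
    (hvan : ∀ (f' : ((UnitaryGroup.arch (↥(maximalRealSubfield L)) L (IsCMField.complexConj L) 3 H → ℂ) ×
      (∀ v : HeightOneSpectrum (𝓞 ↥(maximalRealSubfield L)), (cmDatum L 3 H).Local v → ℂ)))
      (f : (CompactlySupportedContinuousMap (cmDatum L 3 (Matrix.of fun i j : Fin 3 => if i.val + j.val + 1 = 3 then (1 : L) else 0)).Adelic ℂ)), Smooth f' ∧ Transfer f' f → PSVanish f)
    (hvanH : ∀ (f' : ((UnitaryGroup.arch (↥(maximalRealSubfield L)) L (IsCMField.complexConj L) 3 H → ℂ) ×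
      (∀ v : HeightOneSpectrum (𝓞 ↥(maximalRealSubfield L)), (cmDatum L 3 H).Local v → ℂ)))
      (fH : (CompactlySupportedContinuousMap ((cmDatum L 2 (Matrix.of fun i j : Fin 2 => if i.val + j.val + 1 = 2 then (1 : L) else 0)).Adelic × (cmDatum L 1 (Matrix.of fun i j : Fin 1 => if i.val + j.val + 1 = 1 then (1 : L) else 0)).Adelic) ℂ)), TransferH f' fH → PSVanishH fH)
    (tw : ∀ l : InnerFormSec146.Level L, InnerFormSec146.HeckeOff L H l → (CompactlySupportedContinuousMap (cmDatum L 3 (Matrix.of fun i j : Fin 3 => if i.val + j.val + 1 = 3 then (1 : L) else 0)).Adelic ℂ) → (CompactlySupportedContinuousMap (cmDatum L 3 (Matrix.of fun i j : Fin 3 => if i.val + j.val + 1 = 3 then (1 : L) else 0)).Adelic ℂ))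
    (twH : ∀ l : InnerFormSec146.Level L, InnerFormSec146.HeckeOff L H l →
      (CompactlySupportedContinuousMap ((cmDatum L 2 (Matrix.of fun i j : Fin 2 => if i.val + j.val + 1 = 2 then (1 : L) else 0)).Adelic × (cmDatum L 1 (Matrix.of fun i j : Fin 1 => if i.val + j.val + 1 = 1 then (1 : L) else 0)).Adelic) ℂ) →
      (CompactlySupportedContinuousMap ((cmDatum L 2 (Matrix.of fun i j : Fin 2 => if i.val + j.val + 1 = 2 then (1 : L) else 0)).Adelic × (cmDatum L 1 (Matrix.of fun i j : Fin 1 => if i.val + j.val + 1 = 1 then (1 : L) else 0)).Adelic) ℂ))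
    -- F-LEV-1 (R90-IF-p04 (g3)): the Hecke-twist laws are asked only at levels containing a floor `l₁` (payer: `l₁ ⊇ S₀ ∪ {frameless} ∪ {ramified}`); at a level omitting a
    -- frameless place every packet is ungraded and the unguarded `hEP`∕`hEH` would force all packet traces of a transfer-twist to vanish (jointly unsatisfiable with (14.6.1) + positivity)
    (l₁ : InnerFormSec146.Level L)
    (hTw : ∀ (l : InnerFormSec146.Level L), l₁ ⊆ l → ∀ (h : InnerFormSec146.HeckeOff L H l) (f' : ((UnitaryGroup.arch (↥(maximalRealSubfield L)) L (IsCMField.complexConj L) 3 H → ℂ) ×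
      (∀ v : HeightOneSpectrum (𝓞 ↥(maximalRealSubfield L)), (cmDatum L 3 H).Local v → ℂ)))
      (f : (CompactlySupportedContinuousMap (cmDatum L 3 (Matrix.of fun i j : Fin 3 => if i.val + j.val + 1 = 3 then (1 : L) else 0)).Adelic ℂ)),
      InnerFormSec146.IsLevelTest L ι H T hT l f' → (Smooth f' ∧ Transfer f' f) →
        (Smooth (InnerFormSec146.twistTest L H μv l h f') ∧ Transfer (InnerFormSec146.twistTest L H μv l h f') (tw l h f)))
    (hTHw : ∀ (l : InnerFormSec146.Level L), l₁ ⊆ l → ∀ (h : InnerFormSec146.HeckeOff L H l) (f' : ((UnitaryGroup.arch (↥(maximalRealSubfield L)) L (IsCMField.complexConj L) 3 H → ℂ) ×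
      (∀ v : HeightOneSpectrum (𝓞 ↥(maximalRealSubfield L)), (cmDatum L 3 H).Local v → ℂ)))
      (fH : (CompactlySupportedContinuousMap ((cmDatum L 2 (Matrix.of fun i j : Fin 2 => if i.val + j.val + 1 = 2 then (1 : L) else 0)).Adelic × (cmDatum L 1 (Matrix.of fun i j : Fin 1 => if i.val + j.val + 1 = 1 then (1 : L) else 0)).Adelic) ℂ)),
      InnerFormSec146.IsLevelTest L ι H T hT l f' → TransferH f' fH → TransferH (InnerFormSec146.twistTest L H μv l h f') (twH l h fH))
    (hEP : ∀ (l : InnerFormSec146.Level L), l₁ ⊆ l → ∀ (h : InnerFormSec146.HeckeOff L H l) (f' : ((UnitaryGroup.arch (↥(maximalRealSubfield L)) L (IsCMField.complexConj L) 3 H → ℂ) ×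
      (∀ v : HeightOneSpectrum (𝓞 ↥(maximalRealSubfield L)), (cmDatum L 3 H).Local v → ℂ)))
      (f : (CompactlySupportedContinuousMap (cmDatum L 3 (Matrix.of fun i j : Fin 3 => if i.val + j.val + 1 = 3 then (1 : L) else 0)).Adelic ℂ)),
      InnerFormSec146.IsLevelTest L ι H T hT l f' → (Smooth f' ∧ Transfer f' f) → ∀ P : X.G.Packet,
        X.G.packetTrace X.tr P (tw l h f) =
          ((InnerFormSec146.gradePacket _ _ _ L ι H T hT μA μv (xiPacketFamilyOfRecordSCD L H hH hHd μω hμu μZ keys (hSCD_of_cmCharIdentityPackageTestSigned L H hH hHd μω hμu Δ mH mG νG νH μZ hQS)) 𝔩 X l P).elim 0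
            fun e => InnerFormSec146.evOff L H μv l e h) * X.G.packetTrace X.tr P f)
    (hEH : ∀ (l : InnerFormSec146.Level L), l₁ ⊆ l → ∀ (h : InnerFormSec146.HeckeOff L H l) (f' : ((UnitaryGroup.arch (↥(maximalRealSubfield L)) L (IsCMField.complexConj L) 3 H → ℂ) ×
      (∀ v : HeightOneSpectrum (𝓞 ↥(maximalRealSubfield L)), (cmDatum L 3 H).Local v → ℂ)))
      (fH : (CompactlySupportedContinuousMap ((cmDatum L 2 (Matrix.of fun i j : Fin 2 => if i.val + j.val + 1 = 2 then (1 : L) else 0)).Adelic × (cmDatum L 1 (Matrix.of fun i j : Fin 1 => if i.val + j.val + 1 = 1 then (1 : L) else 0)).Adelic) ℂ)),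
      InnerFormSec146.IsLevelTest L ι H T hT l f' → TransferH f' fH → ∀ ρ : X.G.PacketH,
        X.trH ρ (twH l h fH) =
          ((InnerFormSec146.gradePacketH _ _ _ L ι H T hT μA μv (xiPacketFamilyOfRecordSCD L H hH hHd μω hμu μZ keys (hSCD_of_cmCharIdentityPackageTestSigned L H hH hHd μω hμu Δ mH mG νG νH μZ hQS)) 𝔩 X l ρ).elim 0
            fun e => InnerFormSec146.evOff L H μv l e h) * X.trH ρ fH)
    (hsepL : ∀ l : InnerFormSec146.Level L,
      IsCountablyLinIndepOn (InnerFormSec146.EvpSupport L H μv l) (fun _ : InnerFormSec146.HeckeOff L H l => True) (InnerFormSec146.evOff L H μv l))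
    (hcoverR : ∀ π' : (InnerFormSec146.RepPrimeSph L ι H T hT μA), InnerFormSec146.mPrimeSph L ι H T hT μA π' ≠ 0 → ∀ l₀ : InnerFormSec146.Level L,
      ∃ l : InnerFormSec146.Level L, l₀ ⊆ l ∧ ∃ (e : InnerFormSec146.Evp L H) (f₀ : ((UnitaryGroup.arch (↥(maximalRealSubfield L)) L (IsCMField.complexConj L) 3 H → ℂ) ×
      (∀ v : HeightOneSpectrum (𝓞 ↥(maximalRealSubfield L)), (cmDatum L 3 H).Local v → ℂ)))
        (f : (CompactlySupportedContinuousMap (cmDatum L 3 (Matrix.of fun i j : Fin 3 => if i.val + j.val + 1 = 3 then (1 : L) else 0)).Adelic ℂ))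
        (fH : (CompactlySupportedContinuousMap ((cmDatum L 2 (Matrix.of fun i j : Fin 2 => if i.val + j.val + 1 = 2 then (1 : L) else 0)).Adelic × (cmDatum L 1 (Matrix.of fun i j : Fin 1 => if i.val + j.val + 1 = 1 then (1 : L) else 0)).Adelic) ℂ)),
        InnerFormSec146.gradeRep L ι H T hT μA μv l π' = some e ∧ InnerFormSec146.IsLevelTest L ι H T hT l f₀ ∧ (Smooth f₀ ∧ Transfer f₀ f) ∧ TransferH f₀ fH ∧
          (∀ π : (InnerFormSec146.RepPrimeSph L ι H T hT μA), 0 ≤ (InnerFormSec146.mPrimeSph L ι H T hT μA π : ℂ) * X.trPrime π f₀) ∧ (InnerFormSec146.mPrimeSph L ι H T hT μA π' : ℂ) * X.trPrime π' f₀ ≠ 0)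
    (hframe : ∀ᶠ v : HeightOneSpectrum (𝓞 ↥(maximalRealSubfield L)) in Filter.cofinite,
      ∃ (T₁ : GL (Fin 3) (LocalRing L v)) (a : LocalRing L v) (ha : IsUnit a)
        (h : formCongr (conjLocal L (IsCMField.complexConj L) v) T₁ (H.map (algebraMap L (LocalRing L v))) = a • H'.map (algebraMap L (LocalRing L v))),
        ∀ g : (cmDatum L 3 H).Local v, (cmDatumLocalCongr L v T₁ ha h).symm g ∈ cmLocalIntegralLevel L 3 H' v ↔ g ∈ cmLocalIntegralLevel L 3 H v)
    (htP : ∀ (l : InnerFormSec146.Level L) (P Q : X.G.Packet) (e : InnerFormSec146.Evp L H),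
      InnerFormSec146.gradePacket _ _ _ L ι H T hT μA μv (xiPacketFamilyOfRecordSCD L H hH hHd μω hμu μZ keys (hSCD_of_cmCharIdentityPackageTestSigned L H hH hHd μω hμu Δ mH mG νG νH μZ hQS)) 𝔩 X l P = some e →
      InnerFormSec146.gradePacket _ _ _ L ι H T hT μA μv (xiPacketFamilyOfRecordSCD L H hH hHd μω hμu μZ keys (hSCD_of_cmCharIdentityPackageTestSigned L H hH hHd μω hμu Δ mH mG νG νH μZ hQS)) 𝔩 X l Q = some e → P = Q)
    (hDisj : ∀ v : HeightOneSpectrum (𝓞 ↥(maximalRealSubfield L)), InnerFormSec146.APacketsOfRecordDisjointAt L H (xiPacketFamilyOfRecordSCD L H hH hHd μω hμu μZ keys (hSCD_of_cmCharIdentityPackageTestSigned L H hH hHd μω hμu Δ mH mG νG νH μZ hQS)) v)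
    (htri : X.G.PacketTrichotomy)
    (hApkt : ∀ P : X.G.Packet, X.G.IsAPacket P → ∃ ξ : X.G.PacketH, X.IsOneDimH ξ ∧ X.G.liftsTo ξ P)
    (hliftE : ∀ (l : InnerFormSec146.Level L) (ρ : X.G.PacketH) (P : X.G.Packet) (e : InnerFormSec146.Evp L H),
      InnerFormSec146.gradePacket _ _ _ L ι H T hT μA μv (xiPacketFamilyOfRecordSCD L H hH hHd μω hμu μZ keys (hSCD_of_cmCharIdentityPackageTestSigned L H hH hHd μω hμu Δ mH mG νG νH μZ hQS)) 𝔩 X l P = some e →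
        (X.G.liftsTo ρ P ↔ InnerFormSec146.gradePacketH _ _ _ L ι H T hT μA μv (xiPacketFamilyOfRecordSCD L H hH hHd μω hμu μZ keys (hSCD_of_cmCharIdentityPackageTestSigned L H hH hHd μω hμu Δ mH mG νG νH μZ hQS)) 𝔩 X l ρ = some e))
    -- (LF-cut) ED. 5: NO `hlifts : ∀ P, (X.G.lifts P).Finite` binder — `|Π̂(P)| < ∞` is read only at A-packets, where `lifts P = {ξ}` (`hlifts1`)
    (hnH : ∀ ξ : X.G.PacketH, X.IsOneDimH ξ → X.G.nH ξ = 1)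
    (hli : IsCountablyLinIndepOn (Set.univ : Set (InnerFormSec146.RepPrimeSph L ι H T hT μA))
      (fun φf : ((UnitaryGroup.arch (↥(maximalRealSubfield L)) L (IsCMField.complexConj L) 3 H → ℂ) ×
      (∀ v : HeightOneSpectrum (𝓞 ↥(maximalRealSubfield L)), (cmDatum L 3 H).Local v → ℂ)) =>
        (ArchTestKc L ι H T hT φf.1 ∧ (∀ v, IsLocallyConstant (φf.2 v) ∧ HasCompactSupport (φf.2 v)) ∧
        {v | φf.2 v ≠ (cmLocalIntegralLevel L 3 H v : Set ((cmDatum L 3 H).Local v)).indicator fun _ => (1 : ℂ)}.Finite))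
      (fun π' p => X.trPrime π' p))
    (hex : ∀ φf : ((UnitaryGroup.arch (↥(maximalRealSubfield L)) L (IsCMField.complexConj L) 3 H → ℂ) ×
      (∀ v : HeightOneSpectrum (𝓞 ↥(maximalRealSubfield L)), (cmDatum L 3 H).Local v → ℂ)),
      (ArchTestKc L ι H T hT φf.1 ∧ (∀ v, IsLocallyConstant (φf.2 v) ∧ HasCompactSupport (φf.2 v)) ∧
        {v | φf.2 v ≠ (cmLocalIntegralLevel L 3 H v : Set ((cmDatum L 3 H).Local v)).indicator fun _ => (1 : ℂ)}.Finite) →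
      ∃ (f : (CompactlySupportedContinuousMap (cmDatum L 3 (Matrix.of fun i j : Fin 3 => if i.val + j.val + 1 = 3 then (1 : L) else 0)).Adelic ℂ))
        (fH : (CompactlySupportedContinuousMap ((cmDatum L 2 (Matrix.of fun i j : Fin 2 => if i.val + j.val + 1 = 2 then (1 : L) else 0)).Adelic × (cmDatum L 1 (Matrix.of fun i j : Fin 1 => if i.val + j.val + 1 = 1 then (1 : L) else 0)).Adelic) ℂ)),
        (Smooth φf ∧ Transfer φf f) ∧ TransferH φf fH)
    (hcover𝓣 : ∀ f' : ((UnitaryGroup.arch (↥(maximalRealSubfield L)) L (IsCMField.complexConj L) 3 H → ℂ) ×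
      (∀ v : HeightOneSpectrum (𝓞 ↥(maximalRealSubfield L)), (cmDatum L 3 H).Local v → ℂ)),
      (ArchTestKc L ι H T hT f'.1 ∧ (∀ v, IsLocallyConstant (f'.2 v) ∧ HasCompactSupport (f'.2 v)) ∧
        {v | f'.2 v ≠ (cmLocalIntegralLevel L 3 H v : Set ((cmDatum L 3 H).Local v)).indicator fun _ => (1 : ℂ)}.Finite) → ∀ P : X.G.Packet,
      (∃ π' : (InnerFormSec146.RepPrimeSph L ι H T hT μA), InnerFormSec146.mPrimeSph L ι H T hT μA π' ≠ 0 ∧ InnerFormSec146.evpRep L H μA 𝔩 π'.1 (X.finOfG P)) →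
        ∀ l₀ : InnerFormSec146.Level L, ∃ l : InnerFormSec146.Level L, l₀ ⊆ l ∧ ∃ e : InnerFormSec146.Evp L H,
          InnerFormSec146.IsLevelTest L ι H T hT l f' ∧ InnerFormSec146.gradePacket _ _ _ L ι H T hT μA μv (xiPacketFamilyOfRecordSCD L H hH hHd μω hμu μZ keys (hSCD_of_cmCharIdentityPackageTestSigned L H hH hHd μω hμu Δ mH mG νG νH μZ hQS)) 𝔩 X l P = some e)
    -- S5 — THE E.V.P. RIGIDITY CORE per level (Thm. 13.3.5; p. 242 l. 15), p04 (g2)'s ★ p863121 socket shape `sock_S9_evpRigidityCore_cm` BYTEWISE at generic `X`: germ ⟹ transport off the level for spherical components; `hrig` is DERIVED in-file at the Gelfand levels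
    (hcore : ∀ (l : InnerFormSec146.Level L) (π' : InnerFormSec146.RepPrimeSph L ι H T hT μA) (P : X.G.Packet) (e : InnerFormSec146.Evp L H),
      InnerFormSec146.gradePacket _ _ _ L ι H T hT μA μv (xiPacketFamilyOfRecordSCD L H hH hHd μω hμu μZ keys (hSCD_of_cmCharIdentityPackageTestSigned L H hH hHd μω hμu Δ mH mG νG νH μZ hQS)) 𝔩 X l P = some e →
      (InnerFormSec146.gammaSph _ _ _ L ι H T hT μA (xiPacketFamilyOfRecordSCD L H hH hHd μω hμu μZ keys (hSCD_of_cmCharIdentityPackageTestSigned L H hH hHd μω hμu Δ mH mG νG νH μZ hQS)) 𝔩 X).evpRep π' P →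
        (∀ v, v ∉ l → ((InnerFormSec146.tupleOf L ι H T hT μA π').2 v).IsSpherical (cmLocalIntegralLevel L 3 H v)) →
          ∀ v, v ∉ l → InnerFormSec146.TransportsToSphAt L H 𝔩 v ((InnerFormSec146.tupleOf L ι H T hT μA π').2 v) ((X.finOfG P).loc v))
    (hlifts1 : ∀ (P : X.G.Packet) (ξ : X.G.PacketH), X.G.IsAPacket P → X.IsOneDimH ξ → X.G.liftsTo ξ P → X.G.lifts P = {ξ})
    (hn : ∀ (P : X.G.Packet) (ξ : X.G.PacketH), X.G.IsAPacket P → X.IsOneDimH ξ → X.G.liftsTo ξ P → X.G.n P = 1 / 2)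
    (hvan144G : ∀ (P : X.G.Packet) (ξ : X.G.PacketH) (v : InnerFormSec146.Place L), v ∈ InnerFormSec146.S0 L H → X.IsOneDimH ξ → X.G.liftsTo ξ P → ¬ X.MnNeZero ξ v →
      ∀ (f' : ((UnitaryGroup.arch (↥(maximalRealSubfield L)) L (IsCMField.complexConj L) 3 H → ℂ) ×
      (∀ v : HeightOneSpectrum (𝓞 ↥(maximalRealSubfield L)), (cmDatum L 3 H).Local v → ℂ))) (f : (CompactlySupportedContinuousMap (cmDatum L 3 (Matrix.of fun i j : Fin 3 => if i.val + j.val + 1 = 3 then (1 : L) else 0)).Adelic ℂ)),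
        (ArchTestKc L ι H T hT f'.1 ∧ (∀ v, IsLocallyConstant (f'.2 v) ∧ HasCompactSupport (f'.2 v)) ∧
        {v | f'.2 v ≠ (cmLocalIntegralLevel L 3 H v : Set ((cmDatum L 3 H).Local v)).indicator fun _ => (1 : ℂ)}.Finite) →
        (Smooth f' ∧ Transfer f' f) → X.G.packetTrace X.tr P f = 0)
    (hvan144H : ∀ (ξ : X.G.PacketH) (v : InnerFormSec146.Place L), v ∈ InnerFormSec146.S0 L H → X.IsOneDimH ξ → ¬ X.MnNeZero ξ v →
      ∀ (f' : ((UnitaryGroup.arch (↥(maximalRealSubfield L)) L (IsCMField.complexConj L) 3 H → ℂ) ×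
      (∀ v : HeightOneSpectrum (𝓞 ↥(maximalRealSubfield L)), (cmDatum L 3 H).Local v → ℂ))) (fH : (CompactlySupportedContinuousMap ((cmDatum L 2 (Matrix.of fun i j : Fin 2 => if i.val + j.val + 1 = 2 then (1 : L) else 0)).Adelic × (cmDatum L 1 (Matrix.of fun i j : Fin 1 => if i.val + j.val + 1 = 1 then (1 : L) else 0)).Adelic) ℂ)),
        (ArchTestKc L ι H T hT f'.1 ∧ (∀ v, IsLocallyConstant (f'.2 v) ∧ HasCompactSupport (f'.2 v)) ∧
        {v | f'.2 v ≠ (cmLocalIntegralLevel L 3 H v : Set ((cmDatum L 3 H).Local v)).indicator fun _ => (1 : ℂ)}.Finite) →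
        TransferH f' fH → X.trH ξ fH = 0)
    (hdef : ∀ τ' : L →+* ℂ, InfinitePlace.mk τ' ≠ InfinitePlace.mk ι → (H.map τ').PosDef)
    (hquad : ∀ v : HeightOneSpectrum (𝓞 ↥(maximalRealSubfield L)), (∀ w : PlacesOver L v, IsCMField.complexConj L • w.1 = w.1) →
      IsQuadraticCharExtension (conjLocal L (IsCMField.complexConj L) v) (μω.semilocalComponent L v))
    (hF1b : ∀ P₀ Q₀ : DiscreteAutomorphicRep (adelicGroupData (↥(maximalRealSubfield L)) L (IsCMField.complexConj L) 3 H) μA,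
      InnerFormSec146.IsKcSpherical L ι H T hT μA P₀ → InnerFormSec146.IsKcSpherical L ι H T hT μA Q₀ →
      P₀.UnitaryEquivOfComponents Q₀ (uFormGroup (Fin 2) (Fin 1)) (cmArchSectionUForm L ι H T hT) (cmCompactFactor L ι H T hT))
    (hARCH : ArchComponentOfDiscrete L ι H T hT μA)
    (p : ∀ ξ : X.G.PacketH, X.IsOneDimH ξ → HeightOneSpectrum (𝓞 ↥(maximalRealSubfield L)) → Prop)
    (hp : ∀ (ξ : X.G.PacketH) (h₁ : X.IsOneDimH ξ) (v : HeightOneSpectrum (𝓞 ↥(maximalRealSubfield L))), p ξ h₁ v →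
      ∀ w : PlacesOver L v, IsCMField.complexConj L • w.1 = w.1)
    -- «A2»: the TWO archimedean members `πⁿ(ξ_ι)`, `πˢ(ξ_ι)` at the non-compact place `ι` [§12.3 Prop. 12.3.3] (laws = ★ `globalCharactersLinIndep`'s support conjunct verbatim), distinct
    (a₀ a₂ : ∀ ξ : X.G.PacketH, X.IsOneDimH ξ → GKIrrClass (uFormGroup (Fin 2) (Fin 1)))
    (ha₀ : ∀ (ξ : X.G.PacketH) (h₁ : X.IsOneDimH ξ), ∃ r : GKIrrep (uFormGroup (Fin 2) (Fin 1)), GKIrrClass.mk r = a₀ ξ h₁ ∧ IsAdmissibleGK r.ρK ∧ r.IsInfUnitaryAlongP)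
    (ha₂ : ∀ (ξ : X.G.PacketH) (h₁ : X.IsOneDimH ξ), ∃ r : GKIrrep (uFormGroup (Fin 2) (Fin 1)), GKIrrClass.mk r = a₂ ξ h₁ ∧ IsAdmissibleGK r.ρK ∧ r.IsInfUnitaryAlongP)
    (hane : ∀ (ξ : X.G.PacketH) (h₁ : X.IsOneDimH ξ), a₂ ξ h₁ ≠ a₀ ξ h₁)
    (cpt : ∀ ξ : X.G.PacketH, X.IsOneDimH ξ → Prop) -- «A2» the COMPACT-TYPE GUARD at `ξ` (B: `cptXi₀ ι μω …`): the identities hold on it, the traces VANISH off it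
    (hR₁ : ∀ (P : X.G.Packet) (ξ : X.G.PacketH) (h₁ : X.IsOneDimH ξ), X.G.IsAPacket P → X.G.liftsTo ξ P → cpt ξ h₁ →
      ∀ φf (f : (CompactlySupportedContinuousMap (cmDatum L 3 (Matrix.of fun i j : Fin 3 => if i.val + j.val + 1 = 3 then (1 : L) else 0)).Adelic ℂ)), (ArchTestKc L ι H T hT φf.1 ∧ (∀ v, IsLocallyConstant (φf.2 v) ∧ HasCompactSupport (φf.2 v)) ∧ {v | φf.2 v ≠ (cmLocalIntegralLevel L 3 H v : Set ((cmDatum L 3 H).Local v)).indicator fun _ => (1 : ℂ)}.Finite) →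
      (Smooth φf ∧ Transfer φf f) →
      X.G.packetTrace X.tr P f =
        (-1) ^ (InnerFormSec146.gammaSph _ (CompactlySupportedContinuousMap (cmDatum L 3 (Matrix.of fun i j : Fin 3 => if i.val + j.val + 1 = 3 then (1 : L) else 0)).Adelic ℂ)
          (CompactlySupportedContinuousMap ((cmDatum L 2 (Matrix.of fun i j : Fin 2 => if i.val + j.val + 1 = 2 then (1 : L) else 0)).Adelic × (cmDatum L 1 (Matrix.of fun i j : Fin 1 => if i.val + j.val + 1 = 1 then (1 : L) else 0)).Adelic) ℂ) L ι H T hT μA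
          (xiPacketFamilyOfRecordSCD L H hH hHd μω hμu μZ keys (hSCD_of_cmCharIdentityPackageTestSigned L H hH hHd μω hμu Δ mH mG νG νH μZ hQS)) 𝔩 X).N *
          ((archTr₀ L ι H T hT νinf (a₀ ξ h₁) φf.1 - archTr₀ L ι H T hT νinf (a₂ ξ h₁) φf.1) *
            ∏ v ∈ (xiTruncOfRecordSCD L H hH hHd μω hμu μZ keys (hSCD_of_cmCharIdentityPackageTestSigned L H hH hHd μω hμu Δ mH mG νG νH μZ hQS) μv (X.oneDimOf ξ h₁) φf.2) with ¬ p ξ h₁ v, (letI : MeasurableSpace ((cmDatum L 3 H).Local v) := borel _;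
              (((xiPacketFamilyOfRecordSCD L H hH hHd μω hμu μZ keys (hSCD_of_cmCharIdentityPackageTestSigned L H hH hHd μω hμu Δ mH mG νG νH μZ hQS)) (X.oneDimOf ξ h₁) v).πn).smoothTrace (μv v) (φf.2 v))) *
          ∏ i ∈ (xiTruncOfRecordSCD L H hH hHd μω hμu μZ keys (hSCD_of_cmCharIdentityPackageTestSigned L H hH hHd μω hμu Δ mH mG νG νH μZ hQS) μv (X.oneDimOf ξ h₁) φf.2).subtype (p ξ h₁), (letI : MeasurableSpace ((cmDatum L 3 H).Local i) := borel _;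
            ((((xiPacketFamilyOfRecordSCD L H hH hHd μω hμu μZ keys (hSCD_of_cmCharIdentityPackageTestSigned L H hH hHd μω hμu Δ mH mG νG νH μZ hQS)) (X.oneDimOf ξ h₁) (i : _)).πn).smoothTrace (μv i) (φf.2 i) -
              (((xiPacketFamilyOfRecordSCD L H hH hHd μω hμu μZ keys (hSCD_of_cmCharIdentityPackageTestSigned L H hH hHd μω hμu Δ mH mG νG νH μZ hQS)) (X.oneDimOf ξ h₁) (i : _)).πs.getD ((xiPacketFamilyOfRecordSCD L H hH hHd μω hμu μZ keys (hSCD_of_cmCharIdentityPackageTestSigned L H hH hHd μω hμu Δ mH mG νG νH μZ hQS)) (X.oneDimOf ξ h₁) (i : _)).πn).smoothTrace (μv i) (φf.2 i))))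
    (hR₂ : ∀ (ξ : X.G.PacketH) (h₁ : X.IsOneDimH ξ), cpt ξ h₁ → ∀ φf (fH : (CompactlySupportedContinuousMap ((cmDatum L 2 (Matrix.of fun i j : Fin 2 => if i.val + j.val + 1 = 2 then (1 : L) else 0)).Adelic × (cmDatum L 1 (Matrix.of fun i j : Fin 1 => if i.val + j.val + 1 = 1 then (1 : L) else 0)).Adelic) ℂ)), (ArchTestKc L ι H T hT φf.1 ∧ (∀ v, IsLocallyConstant (φf.2 v) ∧ HasCompactSupport (φf.2 v)) ∧ {v | φf.2 v ≠ (cmLocalIntegralLevel L 3 H v : Set ((cmDatum L 3 H).Local v)).indicator fun _ => (1 : ℂ)}.Finite) →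
      TransferH φf fH →
      X.trH ξ fH =
        (-1) ^ (InnerFormSec146.gammaSph _ (CompactlySupportedContinuousMap (cmDatum L 3 (Matrix.of fun i j : Fin 3 => if i.val + j.val + 1 = 3 then (1 : L) else 0)).Adelic ℂ)
          (CompactlySupportedContinuousMap ((cmDatum L 2 (Matrix.of fun i j : Fin 2 => if i.val + j.val + 1 = 2 then (1 : L) else 0)).Adelic × (cmDatum L 1 (Matrix.of fun i j : Fin 1 => if i.val + j.val + 1 = 1 then (1 : L) else 0)).Adelic) ℂ) L ι H T hT μA
          (xiPacketFamilyOfRecordSCD L H hH hHd μω hμu μZ keys (hSCD_of_cmCharIdentityPackageTestSigned L H hH hHd μω hμu Δ mH mG νG νH μZ hQS)) 𝔩 X).N * (InnerFormSec146.gammaSph _ (CompactlySupportedContinuousMap (cmDatum L 3 (Matrix.of fun i j : Fin 3 => if i.val + j.val + 1 = 3 then (1 : L) else 0)).Adelic ℂ)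
          (CompactlySupportedContinuousMap ((cmDatum L 2 (Matrix.of fun i j : Fin 2 => if i.val + j.val + 1 = 2 then (1 : L) else 0)).Adelic × (cmDatum L 1 (Matrix.of fun i j : Fin 1 => if i.val + j.val + 1 = 1 then (1 : L) else 0)).Adelic) ℂ) L ι H T hT μA
          (xiPacketFamilyOfRecordSCD L H hH hHd μω hμu μZ keys (hSCD_of_cmCharIdentityPackageTestSigned L H hH hHd μω hμu Δ mH mG νG νH μZ hQS)) 𝔩 X).c *
          ((archTr₀ L ι H T hT νinf (a₀ ξ h₁) φf.1 + archTr₀ L ι H T hT νinf (a₂ ξ h₁) φf.1) *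
            ∏ v ∈ (xiTruncOfRecordSCD L H hH hHd μω hμu μZ keys (hSCD_of_cmCharIdentityPackageTestSigned L H hH hHd μω hμu Δ mH mG νG νH μZ hQS) μv (X.oneDimOf ξ h₁) φf.2) with ¬ p ξ h₁ v, (letI : MeasurableSpace ((cmDatum L 3 H).Local v) := borel _;
              (((xiPacketFamilyOfRecordSCD L H hH hHd μω hμu μZ keys (hSCD_of_cmCharIdentityPackageTestSigned L H hH hHd μω hμu Δ mH mG νG νH μZ hQS)) (X.oneDimOf ξ h₁) v).πn).smoothTrace (μv v) (φf.2 v))) *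
          ∏ i ∈ (xiTruncOfRecordSCD L H hH hHd μω hμu μZ keys (hSCD_of_cmCharIdentityPackageTestSigned L H hH hHd μω hμu Δ mH mG νG νH μZ hQS) μv (X.oneDimOf ξ h₁) φf.2).subtype (p ξ h₁), (letI : MeasurableSpace ((cmDatum L 3 H).Local i) := borel _;
            ((((xiPacketFamilyOfRecordSCD L H hH hHd μω hμu μZ keys (hSCD_of_cmCharIdentityPackageTestSigned L H hH hHd μω hμu Δ mH mG νG νH μZ hQS)) (X.oneDimOf ξ h₁) (i : _)).πn).smoothTrace (μv i) (φf.2 i) +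
              (((xiPacketFamilyOfRecordSCD L H hH hHd μω hμu μZ keys (hSCD_of_cmCharIdentityPackageTestSigned L H hH hHd μω hμu Δ mH mG νG νH μZ hQS)) (X.oneDimOf ξ h₁) (i : _)).πs.getD ((xiPacketFamilyOfRecordSCD L H hH hHd μω hμu μZ keys (hSCD_of_cmCharIdentityPackageTestSigned L H hH hHd μω hμu Δ mH mG νG νH μZ hQS)) (X.oneDimOf ξ h₁) (i : _)).πn).smoothTrace (μv i) (φf.2 i))))
    -- «A2» OFF COMPACT TYPE both traces VANISH on the test class [Props. 14.4.1 (a), 14.4.2 (c)]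
    (hR₀G : ∀ (P : X.G.Packet) (ξ : X.G.PacketH) (h₁ : X.IsOneDimH ξ), X.G.IsAPacket P → X.G.liftsTo ξ P → ¬ cpt ξ h₁ →
      ∀ φf (f : (CompactlySupportedContinuousMap (cmDatum L 3 (Matrix.of fun i j : Fin 3 => if i.val + j.val + 1 = 3 then (1 : L) else 0)).Adelic ℂ)), (ArchTestKc L ι H T hT φf.1 ∧ (∀ v, IsLocallyConstant (φf.2 v) ∧ HasCompactSupport (φf.2 v)) ∧ {v | φf.2 v ≠ (cmLocalIntegralLevel L 3 H v : Set ((cmDatum L 3 H).Local v)).indicator fun _ => (1 : ℂ)}.Finite) →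
      (Smooth φf ∧ Transfer φf f) → X.G.packetTrace X.tr P f = 0)
    (hR₀H : ∀ (ξ : X.G.PacketH) (h₁ : X.IsOneDimH ξ), ¬ cpt ξ h₁ → ∀ φf (fH : (CompactlySupportedContinuousMap ((cmDatum L 2 (Matrix.of fun i j : Fin 2 => if i.val + j.val + 1 = 2 then (1 : L) else 0)).Adelic × (cmDatum L 1 (Matrix.of fun i j : Fin 1 => if i.val + j.val + 1 = 1 then (1 : L) else 0)).Adelic) ℂ)), (ArchTestKc L ι H T hT φf.1 ∧ (∀ v, IsLocallyConstant (φf.2 v) ∧ HasCompactSupport (φf.2 v)) ∧ {v | φf.2 v ≠ (cmLocalIntegralLevel L 3 H v : Set ((cmDatum L 3 H).Local v)).indicator fun _ => (1 : ℂ)}.Finite) →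
      TransferH φf fH → X.trH ξ fH = 0)
    (Pξ : X.G.Packet) (hA : X.G.IsAPacket Pξ)
    (hevpXi : InnerFormSec146.evp L H μA (xiPacketFamilyOfRecordSCD L H hH hHd μω hμu μZ keys (hSCD_of_cmCharIdentityPackageTestSigned L H hH hHd μω hμu Δ mH mG νG νH μZ hQS)) 𝔩
      (InnerFormSec146.piXiPrime L H μA (xiPacketFamilyOfRecordSCD L H hH hHd μω hμu μZ keys (hSCD_of_cmCharIdentityPackageTestSigned L H hH hHd μω hμu Δ mH mG νG νH μZ hQS)) ξ) (X.finOfG Pξ))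
    -- (γ2) S5's ROUTING TOKEN «a.e. routed through `Π′(ξ)`» (`Theorems/R90S5ATransportOfRows.lean` :79–:80 at `Ξ := Ξ_recordSCD`) IN PLACE OF the head's (AE) binder `hAE` [Thm. 14.6.4 p. 244]
    (hrt : ∀ᶠ v : HeightOneSpectrum (𝓞 ↥(maximalRealSubfield L)) in Filter.cofinite,
      clFinChoice P v = ((xiPacketFamilyOfRecordSCD L H hH hHd μω hμu μZ keys (hSCD_of_cmCharIdentityPackageTestSigned L H hH hHd μω hμu Δ mH mG νG νH μZ hQS)) ξ v).πn) :
    -- (γ2) THE ENVELOPE: `P` lies in the ξ-local family of record [Thm. 14.6.4 pp. 243–244; §13.3 p. 201]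
    MemXiFamily P hH hHd μω hμu ξ := by
  have hμ : ∀ v, (letI : MeasurableSpace ((cmDatum L 3 H).Local v) := borel _; (μv v).IsHaarMeasure) := hPH.2.2.1
  have hμK1 : ∀ v, μv v (cmLocalIntegralLevel L 3 H v : Set ((cmDatum L 3 H).Local v)) = 1 := hPH.2.2.2.1
  have hν : (letI : MeasurableSpace (UnitaryGroup.arch (↥(maximalRealSubfield L)) L (IsCMField.complexConj L) 3 H) := borel _; νinf.IsHaarMeasure) := hPH.2.1
  have hleft : ∀ v, (letI : MeasurableSpace ((cmDatum L 3 H).Local v) := borel _; (μv v).IsMulLeftInvariant) :=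
    fun v => letI : MeasurableSpace ((cmDatum L 3 H).Local v) := borel _; (hμ v).toIsMulLeftInvariant
  have hχ𝓕 := chiExpansion_gammaSph_of_allClasses_tensOfPair_levels _ _ L ι H T hT μA _ 𝔩 X ν νinf μv hanis (archFinTraceSplit_of_frame L H ι T hT μA ν νinf μv hdef h2) hPH
    (fun l => InnerFormSec146.IsLevelTest L ι H T hT l) (fun l p hp => ⟨hp.1, hp.2.1, hp.2.2.2⟩) hspecAll htrX
  -- J8-R1∕R2 — (14.6.1) AT `Γ₀` ON THE STABLE ROUTE: Prop. 13.6.1-readings `hG`, `hH61` + vanishing classes + Thm. 14.5.1 (b) (kit shape `h51k`, curried = SEAM 8), ★ `Ch14Bridge.thm1461_of_thm1451b`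
  have h61 := Ch14Bridge.thm1461_of_thm1451b
    (InnerFormSec146.gammaSph _ _ _ L ι H T hT μA (xiPacketFamilyOfRecordSCD L H hH hHd μω hμu μZ keys (hSCD_of_cmCharIdentityPackageTestSigned L H hH hHd μω hμu Δ mH mG νG νH μZ hQS)) 𝔩 X)
    (fun f' f => Smooth f' ∧ Transfer f' f) TransferH hG hH61 hvan hvanH (fun f' f fH hT' hH' => h51k f' f fH hT'.1 ⟨hT'.2, hH'⟩)
  obtain ⟨l₀, hgel⟩ := InnerFormSec146.exists_level_forall_smoothTrace_eq_zero_of_not_isSpherical L H μv hH hHd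
    (fun v => letI : MeasurableSpace ((cmDatum L 3 H).Local v) := borel _; ⟨(hμ v).toIsMulLeftInvariant, inferInstance⟩)
  -- ON THE DEEP LEVELS `{l // l₀ ∪ l₁ ⊆ l}` (`l₀` = Gelfand level, ★ p04 (c′); `l₁` = the twist-law floor, F-LEV-1): `hlevTA` ((14.6.2) level sums from `h61` AT ONE GRADED PACKET with finitely many lifts, ★ p863577), `hrigD` (S5 core + Gelfand, ★ p04 (e5′)), `hmn` (★ p863655 `…partnerA`), `hcoeffMem` (★ p863643 `…partnerA'`)
  have hlevTA := fun l : {l : InnerFormSec146.Level L // l₀ ∪ l₁ ⊆ l} =>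
    eq1462LevelTsum_at_of_thm1461_of_separation' (InnerFormSec146.gammaSph _ _ _ L ι H T hT μA (xiPacketFamilyOfRecordSCD L H hH hHd μω hμu μZ keys (hSCD_of_cmCharIdentityPackageTestSigned L H hH hHd μω hμu Δ mH mG νG νH μZ hQS)) 𝔩 X) (fun f' f => Smooth f' ∧ Transfer f' f) TransferH h61
      (InnerFormSec146.IsLevelTest L ι H T hT l.1) (hχ𝓕 l.1) (InnerFormSec146.evOff L H μv l.1) (InnerFormSec146.EvpSupport L H μv l.1) (InnerFormSec146.gradeRep L ι H T hT μA μv l.1) (InnerFormSec146.gradePacket _ _ _ L ι H T hT μA μv _ 𝔩 X l.1) (InnerFormSec146.gradePacketH _ _ _ L ι H T hT μA μv _ 𝔩 X l.1)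
      (fun π' e h => InnerFormSec146.gradeRep_mem_evpSupport L ι H T hT μA μv l.1 π' e h) (fun P e h => InnerFormSec146.gradePacket_mem_evpSupport _ _ L ι H T hT μA μv _ 𝔩 X l.1 P e h) (fun ρ e h => InnerFormSec146.gradePacketH_mem_evpSupport _ _ L ι H T hT μA μv _ 𝔩 X l.1 ρ e h)
      (InnerFormSec146.twistTest L H μv l.1) (tw l.1) (twH l.1) (fun h f' hf' => InnerFormSec146.isLevelTest_twistTest L ι H T hT μv hleft l.1 h f' hf') (hTw l.1 (Finset.union_subset_right l.2)) (hTHw l.1 (Finset.union_subset_right l.2)) (fun h f' hf' π' => InnerFormSec146.trPrime_twistTest_eq_of_factorised L ι H T hT μA μv _ _ _ 𝔩 X hanis hμ hμK1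
        (fun π' φ => archTr₀ L ι H T hT νinf (InnerFormSec146.tupleOf L ι H T hT μA π').1 φ) htrX l.1 (fun v hv c hc => hgel l.1 (Finset.union_subset_left l.2) v hv c hc) h f' hf' π') (hEP l.1 (Finset.union_subset_right l.2)) (hEH l.1 (Finset.union_subset_right l.2)) (hsepL l.1) (htP l.1) (hliftE l.1)
  have hrigD := fun l : {l : InnerFormSec146.Level L // l₀ ∪ l₁ ⊆ l} => InnerFormSec146.gradeRep_eq_of_evpRigidityCore _ _ L ι H T hT μA μv _ 𝔩 X hanis hμ hμK1
    (fun π' φ => archTr₀ L ι H T hT νinf (InnerFormSec146.tupleOf L ι H T hT μA π').1 φ) htrX l.1 (fun v hv c hc => hgel l.1 (Finset.union_subset_left l.2) v hv c hc) (hcore l.1)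
  have hmn := hmn_of_levels_of_partnerA
    (InnerFormSec146.gammaSph _ _ _ L ι H T hT μA (xiPacketFamilyOfRecordSCD L H hH hHd μω hμu μZ keys (hSCD_of_cmCharIdentityPackageTestSigned L H hH hHd μω hμu Δ mH mG νG νH μZ hQS)) 𝔩 X)
    (fun f' f => Smooth f' ∧ Transfer f' f) TransferH _ Set.univ (fun π' _ => Set.mem_univ π') hli hex
    (Λ := {l : InnerFormSec146.Level L // l₀ ∪ l₁ ⊆ l}) (fun l => InnerFormSec146.IsLevelTest L ι H T hT l.1)
    (fun l => InnerFormSec146.gradeRep L ι H T hT μA μv l.1) (fun l => InnerFormSec146.gradePacket _ _ _ L ι H T hT μA μv _ 𝔩 X l.1)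
    (fun f' hF P hP => by
      obtain ⟨l, hl, e, hFl, hPl⟩ := hcover𝓣 f' hF P hP (l₀ ∪ l₁)
      exact ⟨⟨l, hl⟩, e, hFl, hPl⟩)
    -- (LF-cut) the `HasSum` level identity AT THE A-PACKET `(P, ξ)` of the (MN) argument: ★ p863577 at `(P, e)` with `|Π̂(P)| < ∞` from `lifts P = {ξ}`, converted POINTWISE (★ p863705 §1)
    (fun l f' f fH hFl hf hfH P ξ hAP h₁ hlift e hP => hasSum_fibre_indicator_of_tsum_eq_at (InnerFormSec146.gammaSph _ _ _ L ι H T hT μA (xiPacketFamilyOfRecordSCD L H hH hHd μω hμu μZ keys (hSCD_of_cmCharIdentityPackageTestSigned L H hH hHd μω hμu Δ mH mG νG νH μZ hQS)) 𝔩 X)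
      (InnerFormSec146.gradeRep L ι H T hT μA μv l.1) f' (hχ𝓕 l.1 f' hFl).1 e (hlevTA l f' f fH hFl hf hfH P e hP ((Set.finite_singleton ξ).subset (hlifts1 P ξ hAP h₁ hlift).subset)))
    (fun l π' P e hP hπ => InnerFormSec146.evpRep_gammaSph_of_grade_eq _ _ L ι H T hT μA μv _ 𝔩 X hμ l.1 π' P e hP hπ)
    (fun l f' hF π' P e hP hevp hne => hrigD l f' hF π' P e hP hevp hne) hlifts1 hn hnH hvan144G hvan144H
  have hcoeffMem := hcoeffMem_binder_gammaSph_recordSCD_atUnitsOfRecord_partnerA2' L ι H T hT νinf μv hdef hν hμ hH hHd μω hμu μZ keys _ μA 𝔩 hμω hquad hμK1 hanis hF1b hARCH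
    X (fun f' f => Smooth f' ∧ Transfer f' f) TransferH htrX p hp a₀ a₂ ha₀ ha₂ hane cpt hR₁ hR₂ hR₀G hR₀H
    (fun l : {l : InnerFormSec146.Level L // l₀ ∪ l₁ ⊆ l} => InnerFormSec146.IsLevelTest L ι H T hT l.1)
    (fun l f' h => (hχ𝓕 l.1 f' h).1)
    (fun l => InnerFormSec146.gradeRep L ι H T hT μA μv l.1) (fun l => InnerFormSec146.gradePacket _ _ _ L ι H T hT μA μv _ 𝔩 X l.1)
      -- (CMP-cov) VERDICT (ⅱ): the partner-guarded cover `hcoverP` from the SAME `hcover𝓣` that feeds `hmn` (★ p863134 pays it at `X_cm`)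
      (fun f' _ P hφ hpart _ => by
        obtain ⟨l, hl, e, hF, hP⟩ := hcover𝓣 f' hφ P hpart (l₀ ∪ l₁)
        exact ⟨⟨l, hl⟩, e, hF, hP⟩)
    -- (LF-cut) the `tsum` level identity AT THE A-PACKET `(P, ξ)` of the (CMP) argument, `|Π̂(P)| < ∞` from `lifts P = {ξ}`
    (fun l f' f fH hF hf hfH P ξ hA h₁ hl e hP => hlevTA l f' f fH hF hf hfH P e hP ((Set.finite_singleton ξ).subset (hlifts1 P ξ hA h₁ hl).subset))
    (fun l π' P e hP hπ => InnerFormSec146.evpRep_gammaSph_of_grade_eq _ _ L ι H T hT μA μv _ 𝔩 X hμ l.1 π' P e hP hπ)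
    (fun l f' hF π' P e hP hevp hne => hrigD l f' hF π' P e hP hevp hne)
    hlifts1 hn hnH hex
  -- (S7) §14.6 FOR `D = M₃(E)` at `Γ₀` from (14.6.1): `h64 := sec146_of_levels'` on the deep levels — ★ M3's engine argument TOKEN FOR TOKEN ((δ1)∕(δ6a)'s instantiation, every pin by its ★ name)
  have h64 := sec146_of_levels' (InnerFormSec146.gammaSph _ _ _ L ι H T hT μA (xiPacketFamilyOfRecordSCD L H hH hHd μω hμu μZ keys (hSCD_of_cmCharIdentityPackageTestSigned L H hH hHd μω hμu Δ mH mG νG νH μZ hQS)) 𝔩 X)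
    (fun f' f => Smooth f' ∧ Transfer f' f) TransferH (fun l : {l : InnerFormSec146.Level L // l₀ ∪ l₁ ⊆ l} => InnerFormSec146.IsLevelTest L ι H T hT l.1) (fun l => hχ𝓕 l.1) (fun l => InnerFormSec146.evOff L H μv l.1) (fun l => InnerFormSec146.EvpSupport L H μv l.1)
      (fun l => InnerFormSec146.gradeRep L ι H T hT μA μv l.1) (fun l => InnerFormSec146.gradePacket _ _ _ L ι H T hT μA μv _ 𝔩 X l.1) (fun l => InnerFormSec146.gradePacketH _ _ _ L ι H T hT μA μv _ 𝔩 X l.1) (fun l π' e h => InnerFormSec146.gradeRep_mem_evpSupport L ι H T hT μA μv l.1 π' e h)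
      (fun l P e h => InnerFormSec146.gradePacket_mem_evpSupport _ _ L ι H T hT μA μv _ 𝔩 X l.1 P e h) (fun l ρ e h => InnerFormSec146.gradePacketH_mem_evpSupport _ _ L ι H T hT μA μv _ 𝔩 X l.1 ρ e h) (fun l => InnerFormSec146.twistTest L H μv l.1) (fun l => tw l.1) (fun l => twH l.1)
      (fun l h f' hf' => InnerFormSec146.isLevelTest_twistTest L ι H T hT μv hleft l.1 h f' hf') (fun l => hTw l.1 (Finset.union_subset_right l.2)) (fun l => hTHw l.1 (Finset.union_subset_right l.2)) (fun l h f' hf' π' => InnerFormSec146.trPrime_twistTest_eq_of_factorised L ι H T hT μA μv _ _ _ 𝔩 X hanis hμ hμK1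
        (fun π' φ => archTr₀ L ι H T hT νinf (InnerFormSec146.tupleOf L ι H T hT μA π').1 φ) htrX l.1 (fun v hv c hc => hgel l.1 (Finset.union_subset_left l.2) v hv c hc) h f' hf' π') (fun l => hEP l.1 (Finset.union_subset_right l.2)) (fun l => hEH l.1 (Finset.union_subset_right l.2)) (fun l => hsepL l.1) (fun l ρ e h => InnerFormSec146.exists_gradePacket_of_gradePacketH _ _ _ L ι H T hT μA μv _ 𝔩 X l.1 ρ e h)
      (fun π' hm => by
        obtain ⟨l, hl, e, f₀, f, fH, h⟩ := hcoverR π' hm (l₀ ∪ l₁)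
        exact ⟨⟨l, hl⟩, e, f₀, f, fH, h⟩) (fun l π' P e hP hπ => InnerFormSec146.evpRep_gammaSph_of_grade_eq _ _ L ι H T hT μA μv _ 𝔩 X hμ l.1 π' P e hP hπ) (fun π' P Q hP hQ => by
        obtain ⟨l, hl, e, h₁, h₂⟩ := InnerFormSec146.exists_level_gradePacket_eq_of_evpRep _ _ _ L ι H T hT μA μv _ 𝔩 X hanis hframe π' P Q hP hQ (l₀ ∪ l₁)
        exact ⟨⟨l, hl⟩, e, h₁, h₂⟩) (fun l P Q e hP hQ => htP l.1 P Q e hP hQ) (fun π' P' Q hm' => InnerFormSec146.evpRep_iff_evp_of_memPrime L H μA _ hanis (pisSlotsNotSphericalCofinite_recordSCD L H hH hHd μω hμu μZ keys _) 𝔩 π'.1 P' hm' (X.finOfG Q)) (fun π' _ => InnerFormSec146.exists_memPrime L H μA _ hanis π'.1)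
      (fun π' P' Q' hP' hQ' => InnerFormSec146.memPrime_unique L H μA _ hanis hDisj π'.1 P' Q' hP' hQ') htri hApkt hmn hcoeffMem
  -- `hevp` at the datum FROM THE ROUTING TOKEN: «a.e. routed through Π′(ξ)» + «t(Π′(ξ)) = t(Π(ξ))» (`hevpXi`, ★ `evp_piXiPrime_iff`) ⟹ «t([P]) = t(Π(ξ))» (★ `evpRepOf_of_eventuallyEq_of_evpFin`), read as `Γ₀.evpRep [P] Π(ξ)` by `rfl`
  have hevp : (InnerFormSec146.gammaSph _ _ _ L ι H T hT μA (xiPacketFamilyOfRecordSCD L H hH hHd μω hμu μZ keys (hSCD_of_cmCharIdentityPackageTestSigned L H hH hHd μω hμu Δ mH mG νG νH μZ hQS)) 𝔩 X).evpRep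
      (InnerFormSec146.classOfSph L ι H T hT μA P hsph) Pξ :=
    (InnerFormSec146.gammaSph_evpRep_classOfSph _ _ _ L ι H T hT μA _ 𝔩 X P hsph Pξ).2
      (evpRepOf_of_eventuallyEq_of_evpFin L H μA 𝔩 P _ (X.finOfG Pξ) hrt ((InnerFormSec146.evp_piXiPrime_iff L H μA _ 𝔩 ξ (X.finOfG Pξ)).1 hevpXi))
  -- THE ENGINE'S CORE (★ `definiteAeRigidityAt_of_thm1461'` :234–:242) WITHOUT `hback`: partition ⟹ `[P] ∈ Π′` (`m′ ≠ 0`); `t(Π′) = t(Π(ξ))` so `Π′ ∈ Π_a(G′)`; Thm. 14.6.4 (a): `Π′ = Π′(ξ′)` [p. 242, p. 244]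
  obtain ⟨hevp', hpart, h64a⟩ := h64 h61
  obtain ⟨P', hmem⟩ := hpart.2.2 (InnerFormSec146.classOfSph L ι H T hT μA P hsph) (InnerFormSec146.gammaSph_m'_ne_zero _ _ _ L ι H T hT μA _ 𝔩 X hanis _)
  have hevpP : (InnerFormSec146.gammaSph _ _ _ L ι H T hT μA _ 𝔩 X).evp P' Pξ := (hevp'.2 _ P' Pξ hmem).1 hevp
  obtain ⟨ξ', h₁, hS, hP'⟩ := h64a (InnerFormSec146.gammaSph_dSplit _ _ _ L ι H T hT μA _ 𝔩 X) P'
    ⟨⟨InnerFormSec146.classOfSph L ι H T hT μA P hsph, hmem, InnerFormSec146.gammaSph_m'_ne_zero _ _ _ L ι H T hT μA _ 𝔩 X hanis _⟩, Pξ, hevpP, hA⟩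
  subst hP'
  -- ENVELOPE READ-BACK KEPT WHOLE (split places included): `[P] ∈ Π′(ξ′)` IS `LocalConstituentsIn P (Ξ_rec ξ″)`, `ξ″ := oneDimOf ξ′ h₁` (`rfl`); `Ξ_rec ξ″` IS a ξ″-local family ⟹ `MemXiFamily P … ξ″` [§13.3 p. 201]
  have hLC := (InnerFormSec146.gammaSph_mem'_piXi'_classOfSph _ _ _ L ι H T hT μA _ 𝔩 X P hsph ξ' h₁ hS).1 hmem
  have hmemF : MemXiFamily P hH hHd μω hμu (X.oneDimOf ξ' h₁) :=
    ⟨_, F0P3XiPacketFamilyOfRecordSCD.isXiLocalFamily_xiPacketFamilyOfRecordSCD L H hH hHd μω hμu μZ keys _ (X.oneDimOf ξ' h₁), hLC⟩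
  -- Thm. 14.6.4's UNIQUE `ξ`: the token reads ★ `RoutesAt … P ξ v` off its exceptional set (split packet ∕ Keys' non-`L²` label along EVERY frame by congruence independence); routed by `ξ` inside the `ξ″`-envelope ⟹ `ξ = ξ″` (split places, ★ S5)
  obtain ⟨S₁, hS₁⟩ : ∃ S₁ : Finset (HeightOneSpectrum (𝓞 ↥(maximalRealSubfield L))), ∀ v, v ∉ S₁ →
      clFinChoice P v = ((xiPacketFamilyOfRecordSCD L H hH hHd μω hμu μZ keys (hSCD_of_cmCharIdentityPackageTestSigned L H hH hHd μω hμu Δ mH mG νG νH μZ hQS)) ξ v).πn :=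
    ⟨(Filter.eventually_cofinite.1 hrt).toFinset, fun v hv => not_not.1 fun h => hv ((Set.Finite.mem_toFinset _).2 h)⟩
  have hroute : ∀ v, v ∉ S₁ → F0P3CohClassRoutingCot.RoutesAt L H hH hHd μω hμu μZ keys μA P ξ v := by
    intro v hv
    refine ⟨fun hs => ?_, fun hns T a ha h _ => ?_⟩
    · rw [hS₁ v hv, F0P3XiPacketFamilyOfRecordSCD.xiPacketFamilyOfRecordSCD_of_split L H hH hHd μω hμu μZ keys _ ξ v hs]
    · obtain ⟨T₀, a₀, ha₀, h₀, hΞ, -⟩ := F0P3XiPacketFamilyOfRecordSCD.xiPacketFamilyOfRecordSCD_of_nonsplit L H hH hHd μω hμu μZ keys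
        (hSCD_of_cmCharIdentityPackageTestSigned L H hH hHd μω hμu Δ mH mG νG νH μZ hQS) ξ v hns
      rw [hS₁ v hv, hΞ]
      exact F0P3cDbTEnvelopeTrichotomy.comap_cmDatumLocalCongr_symm_eq L H hH T₀ T ha₀ ha h₀ h _
  have hξ : ξ = X.oneDimOf ξ' h₁ :=
    R90.S5.xi_eq_of_routesAt_of_memXiFamily_of_not_mem L H hH hHd μω hμu μZ keys μA P ξ (X.oneDimOf ξ' h₁) S₁ hroute hmemF
      (fun v _ => R90.S5.admUnitConstituents_nonempty_of_anisotropic L H μA hanis P v)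
  rw [hξ]
  exact hmemF

end Summit.HodgeConjecture.HodgeConjecture.R90.S9

end
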